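import Summits.QuantumFields.YangMills.Theorems.PoincareLipschitzStretchedOfImprove
import Summits.QuantumFields.YangMills.Theorems.PoincareLipschitzImproveOfCore
import Summits.QuantumFields.YangMills.Theorems.PoincareLipschitzImproveCoreOfFlat

/-!
# Crux `HistoryTailL` (stmt-QuantumFields-19936), line #12 — THE ψ_α GLUE (S6): THE K2 DISPLAY v3∕v4 ON THE K1 SHAPE AXIS —
# `HistoryTailL ⟸ {K1-ψ_α | K1-moments(α)} ∧ {hImproveCore | hImproveCoreFlat} ∧ MeanDeviationL`, for every `α > 0`

Cell `ym3-torus` (YM ladder rung R3 = continuum SU(2) Yang–Mills on the 3-torus — NOT d = 4, NOT infinite volume, NOT a mass gap, NOT the Clay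
problem), width seat `ym-ust-19936-w4` gen 14; `--supports stmt-QuantumFields-19936 --as helper`.  After the LEAD's K-3 (✓p707954
`blockLipschitzL_of_hImprove`), w2's K-4 (✓`PoincareLipschitzImproveOfCore.hImprove_of_core`: the frozen organ `hImprove` v1 899858e5 follows from
its CORE `hImproveCore` v1 7446c95a — «bounded normalised energy ⟹ normalised energy ≤ ε₁ at ONE comparable scale» for twisted lattice almost-minimisers
into `S³`) and the LEAD's K-5 (✓`PoincareLipschitzImproveCoreOfFlat.hImproveCore_of_flat`: the core follows from its TWIST-FREE, GAUGE-FREE form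
`hImproveCoreFlat` bac8eda3), the K2 display of record can be written over the core organ; THIS FILE writes it with the K1 binder in its two weakest
typed SHAPES (S3 ✓`historyTailL_of_stretchedConcentration`, S4 ✓`historyTailL_of_momentGrowth`, composed in S5 with K-3): for every `α > 0`,

* ★★★`historyTailL_of_stretchedConcentration_of_hImproveCore (α) (hα) (hC : K1-ψ_α) (hCore : hImproveCore) (hM : MeanDeviationL) : HistoryTailL`,
* ★★★`historyTailL_of_momentGrowth_of_hImproveCore (α) (hα) (hMom : K1-moments(α)) (hCore) (hM) : HistoryTailL`,
* ★★★`historyTailL_of_stretchedConcentration_of_hImproveCoreFlat (α) (hα) (hC) (hF : hImproveCoreFlat) (hM) : HistoryTailL`,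
* ★★★`historyTailL_of_momentGrowth_of_hImproveCoreFlat (α) (hα) (hMom) (hF) (hM) : HistoryTailL`,

all by `exact` (pure composition; the `hImproveCore` ∕ `hImproveCoreFlat` texts are K-4's ∕ K-5's binders VERBATIM).  HONEST: corollaries only;
`hImproveCoreFlat` (the K2 residue of record: Schoen–Uhlenbeck-class bounded-energy regularity for lattice almost-minimisers `ℤ³ → S³`, not in print on
the lattice), K1 (in any shape), `MeanDeviationL` are OPEN; nothing of the cruxes, rung R3 or the mass gap is proved.  THEOREMS ONLY, definition-free.
[cite: Balaban1985UV3, (7) p.257 and (71) p.273; Balaban1987RG1, (0.14) p.254]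
-/

set_option autoImplicit false

noncomputable section

namespace Summit.QuantumFields.YangMills.Theorems.PoincareLipschitzStretched

open MeasureTheory
open scoped BigOperators
open Literature.MathematicalPhysics.QuantumFieldTheory.Balaban1983to89
open Literature.MathematicalPhysics.QuantumFieldTheory.Balaban1983to89.T3ContinuumYM3Torus
open Literature.MathematicalPhysics.QuantumFieldTheory.Balaban1983to89.T3UnitScaleTilt
open Literature.MathematicalPhysics.QuantumFieldTheory.Balaban1983to89.T3UnitLawDensityEML (ℰp)
open B4Eq19LatticeOperators (Zd box unitVec)
open Summit.QuantumFields.YangMills.Theorems.PoincareLipschitzImproveOfCore (hImprove_of_core)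
open Summit.QuantumFields.YangMills.Theorems.PoincareLipschitzImproveCoreOfFlat (hImproveCore_of_flat)

/-- ★★★ **K2 DISPLAY v3 × K1 SHAPE AXIS (ψ_α)**: `UnitScaleTilt.HistoryTailL ⟸ K1-ψ_α ∧ hImproveCore ∧ MeanDeviationL` for every `α > 0` — the
concentration binder of ANY stretched-exponential shape at the Hodge–Poincaré scale (S3) and the K2 crux discharged modulo the CORE organ
`hImproveCore` (K-3 ∘ K-4: ✓`blockLipschitzL_of_hImprove` ∘ ✓`hImprove_of_core`).  Pure composition. [cite: Balaban1985UV3, (7) p.257 and (71) p.273] -/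
theorem historyTailL_of_stretchedConcentration_of_hImproveCore (α : ℝ) (hα : 0 < α)
    (hC : ∀ (L : ℕ), ∃ (Cc cc : ℝ), 0 ≤ Cc ∧ 0 < cc ∧ ∃ γ₁ : ℝ, 0 < γ₁ ∧ γ₁ ≤ 1 ∧
      ∀ (F : T3Family) (γ : ℝ), F.L = L → 0 < γ → γ ≤ γ₁ → ∀ (K n : ℕ), 1 ≤ n →
        (n : ℝ) ≤ (F.scheme ℰp γ).β K → 2 * n ≤ (F.P K).sitesPerDir 0 →
        ∀ (x₀ : Site (F.P K) 0) (f : GaugeField (F.P K) 0 (Matrix.specialUnitaryGroup (Fin 2) ℂ) → ℝ) (Λ : ℝ), 0 < Λ →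
          Measurable f → GaugeField.GaugeInvariant f →
          (∀ U U' : GaugeField (F.P K) 0 (Matrix.specialUnitaryGroup (Fin 2) ℂ),
            (∀ b : PBond (F.P K) 0, (∀ k, (b.src k - x₀ k).val < n) → (∀ k, (b.tgt k - x₀ k).val < n) → U b = U' b) →
              f U = f U') →
          (∀ U U' : GaugeField (F.P K) 0 (Matrix.specialUnitaryGroup (Fin 2) ℂ),
            |f U - f U'| ≤ Λ * Real.sqrt (∑ b : PBond (F.P K) 0, GaugeGroup.dist1 (U b * (U' b)⁻¹) ^ 2)) →
          ∀ r : ℝ, 0 ≤ r →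
            (gibbsK F ℰp γ K).real {U | r ≤ f U - ∫ V, f V ∂(gibbsK F ℰp γ K)} ≤
              Cc * Real.exp (-(cc * (Real.sqrt ((F.scheme ℰp γ).β K) * r / ((n : ℝ) * Λ)) ^ α)))
    (hCore : ∀ (Λ₀ ε₁ : ℝ), 0 < Λ₀ → 0 < ε₁ →
      ∃ (C₀ R₀ : ℝ), 1 ≤ C₀ ∧ 1 ≤ R₀ ∧
      ∀ (u : Zd 3 → EuclideanSpace ℝ (Fin 4)) (τ : Fin 3 → Zd 3 → (EuclideanSpace ℝ (Fin 4) ≃ₗᵢ[ℝ] EuclideanSpace ℝ (Fin 4)))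
      (z : Zd 3) (R : ℤ) (τ₀ : ℝ),
      R₀ ≤ R →
      (∀ y, ‖u y‖ = 1) →
      (∀ y ∈ box z (R + 1), ∀ (μ : Fin 3) (w : EuclideanSpace ℝ (Fin 4)), ‖τ μ y w - w‖ ≤ τ₀ * ‖w‖) →
      τ₀ * (R : ℝ) ≤ C₀⁻¹ →
      (∀ y ∈ box z R,
      ‖∑ μ : Fin 3, (τ μ y (u (y + unitVec μ)) + (τ μ (y - unitVec μ)).symm (u (y - unitVec μ)))‖ • u y =
      ∑ μ : Fin 3, (τ μ y (u (y + unitVec μ)) + (τ μ (y - unitVec μ)).symm (u (y - unitVec μ)))) →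
      (∀ (z' : Zd 3) (R' : ℤ), 0 ≤ R' → box z' (R' + 1) ⊆ box z R →
      ∀ v : Zd 3 → EuclideanSpace ℝ (Fin 4), (∀ y, y ∉ box z' R' → v y = u y) → (∀ y ∈ box z' R', ‖v y‖ = 1) →
      ∑ y ∈ box z' (R' + 1), ∑ μ : Fin 3, ‖τ μ y (u (y + unitVec μ)) - u y‖ ^ 2 ≤
      ∑ y ∈ box z' (R' + 1), ∑ μ : Fin 3, ‖τ μ y (v (y + unitVec μ)) - v y‖ ^ 2) →
      (∑ y ∈ box z R, ∑ μ : Fin 3, ‖τ μ y (u (y + unitVec μ)) - u y‖ ^ 2 ≤ Λ₀ * R) →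
      ∃ r : ℤ, 1 ≤ r ∧ (R : ℝ) ≤ C₀ * r ∧ 4 * r ≤ R ∧
      ∑ y ∈ box z (2 * r), ∑ μ : Fin 3, ‖τ μ y (u (y + unitVec μ)) - u y‖ ^ 2 ≤ ε₁ * r)
    (hM : Summit.QuantumFields.YangMills.Theses.PoincareLipschitz.MeanDeviationL) :
    Summit.QuantumFields.YangMills.Theses.UnitScaleTilt.HistoryTailL :=
  historyTailL_of_stretchedConcentration_of_hImprove α hα hC (hImprove_of_core hCore) hM

/-- ★★★ **K2 DISPLAY v3 × K1 SHAPE AXIS (moments)**: `UnitScaleTilt.HistoryTailL ⟸ K1-moments(α) ∧ hImproveCore ∧ MeanDeviationL` for every `α > 0` —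
centred-moment growth `‖f − ∫f‖_q ≤ CM·(n·Λ∕√β_K)·q^{1∕α}` of box-local gauge-invariant Lipschitz observables (S4) and the core organ (K-3 ∘ K-4).
Pure composition. [cite: Balaban1985UV3, (7) p.257 and (71) p.273] -/
theorem historyTailL_of_momentGrowth_of_hImproveCore (α : ℝ) (hα : 0 < α)
    (hMom : ∀ (L : ℕ), ∃ (CM : ℝ), 0 < CM ∧ ∃ γ₁ : ℝ, 0 < γ₁ ∧ γ₁ ≤ 1 ∧
      ∀ (F : T3Family) (γ : ℝ), F.L = L → 0 < γ → γ ≤ γ₁ → ∀ (K n : ℕ), 1 ≤ n →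
        (n : ℝ) ≤ (F.scheme ℰp γ).β K → 2 * n ≤ (F.P K).sitesPerDir 0 →
        ∀ (x₀ : Site (F.P K) 0) (f : GaugeField (F.P K) 0 (Matrix.specialUnitaryGroup (Fin 2) ℂ) → ℝ) (Λ : ℝ), 0 < Λ →
          Measurable f → GaugeField.GaugeInvariant f →
          (∀ U U' : GaugeField (F.P K) 0 (Matrix.specialUnitaryGroup (Fin 2) ℂ),
            (∀ b : PBond (F.P K) 0, (∀ k, (b.src k - x₀ k).val < n) → (∀ k, (b.tgt k - x₀ k).val < n) → U b = U' b) →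
              f U = f U') →
          (∀ U U' : GaugeField (F.P K) 0 (Matrix.specialUnitaryGroup (Fin 2) ℂ),
            |f U - f U'| ≤ Λ * Real.sqrt (∑ b : PBond (F.P K) 0, GaugeGroup.dist1 (U b * (U' b)⁻¹) ^ 2)) →
          ∀ q : ℕ, 1 ≤ q →
            ∫ U, |f U - ∫ V, f V ∂(gibbsK F ℰp γ K)| ^ q ∂(gibbsK F ℰp γ K) ≤
              (CM * ((n : ℝ) * Λ / Real.sqrt ((F.scheme ℰp γ).β K)) * (q : ℝ) ^ (1 / α)) ^ q)
    (hCore : ∀ (Λ₀ ε₁ : ℝ), 0 < Λ₀ → 0 < ε₁ →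
      ∃ (C₀ R₀ : ℝ), 1 ≤ C₀ ∧ 1 ≤ R₀ ∧
      ∀ (u : Zd 3 → EuclideanSpace ℝ (Fin 4)) (τ : Fin 3 → Zd 3 → (EuclideanSpace ℝ (Fin 4) ≃ₗᵢ[ℝ] EuclideanSpace ℝ (Fin 4)))
      (z : Zd 3) (R : ℤ) (τ₀ : ℝ),
      R₀ ≤ R →
      (∀ y, ‖u y‖ = 1) →
      (∀ y ∈ box z (R + 1), ∀ (μ : Fin 3) (w : EuclideanSpace ℝ (Fin 4)), ‖τ μ y w - w‖ ≤ τ₀ * ‖w‖) →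
      τ₀ * (R : ℝ) ≤ C₀⁻¹ →
      (∀ y ∈ box z R,
      ‖∑ μ : Fin 3, (τ μ y (u (y + unitVec μ)) + (τ μ (y - unitVec μ)).symm (u (y - unitVec μ)))‖ • u y =
      ∑ μ : Fin 3, (τ μ y (u (y + unitVec μ)) + (τ μ (y - unitVec μ)).symm (u (y - unitVec μ)))) →
      (∀ (z' : Zd 3) (R' : ℤ), 0 ≤ R' → box z' (R' + 1) ⊆ box z R →
      ∀ v : Zd 3 → EuclideanSpace ℝ (Fin 4), (∀ y, y ∉ box z' R' → v y = u y) → (∀ y ∈ box z' R', ‖v y‖ = 1) →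
      ∑ y ∈ box z' (R' + 1), ∑ μ : Fin 3, ‖τ μ y (u (y + unitVec μ)) - u y‖ ^ 2 ≤
      ∑ y ∈ box z' (R' + 1), ∑ μ : Fin 3, ‖τ μ y (v (y + unitVec μ)) - v y‖ ^ 2) →
      (∑ y ∈ box z R, ∑ μ : Fin 3, ‖τ μ y (u (y + unitVec μ)) - u y‖ ^ 2 ≤ Λ₀ * R) →
      ∃ r : ℤ, 1 ≤ r ∧ (R : ℝ) ≤ C₀ * r ∧ 4 * r ≤ R ∧
      ∑ y ∈ box z (2 * r), ∑ μ : Fin 3, ‖τ μ y (u (y + unitVec μ)) - u y‖ ^ 2 ≤ ε₁ * r)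
    (hM : Summit.QuantumFields.YangMills.Theses.PoincareLipschitz.MeanDeviationL) :
    Summit.QuantumFields.YangMills.Theses.UnitScaleTilt.HistoryTailL :=
  historyTailL_of_momentGrowth_of_hImprove α hα hMom (hImprove_of_core hCore) hM

/-- ★★★ **K2 DISPLAY v4 × K1 SHAPE AXIS (ψ_α)**: `UnitScaleTilt.HistoryTailL ⟸ K1-ψ_α ∧ hImproveCoreFlat ∧ MeanDeviationL` for every `α > 0` — the
TWIST-FREE, GAUGE-FREE organ of record (unit `ℝ⁴`-valued lattice maps on `ℤ³` almost-minimising the flat Dirichlet energy in every sub-box with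
slack `δ(ρ+1)` and bounded normalised energy have normalised energy `≤ ε₁` at one comparable scale), via K-3 ∘ K-4 ∘ K-5
(✓`hImproveCore_of_flat`).  Pure composition. [cite: Balaban1985UV3, (7) p.257 and (71) p.273] -/
theorem historyTailL_of_stretchedConcentration_of_hImproveCoreFlat (α : ℝ) (hα : 0 < α)
    (hC : ∀ (L : ℕ), ∃ (Cc cc : ℝ), 0 ≤ Cc ∧ 0 < cc ∧ ∃ γ₁ : ℝ, 0 < γ₁ ∧ γ₁ ≤ 1 ∧
      ∀ (F : T3Family) (γ : ℝ), F.L = L → 0 < γ → γ ≤ γ₁ → ∀ (K n : ℕ), 1 ≤ n →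
        (n : ℝ) ≤ (F.scheme ℰp γ).β K → 2 * n ≤ (F.P K).sitesPerDir 0 →
        ∀ (x₀ : Site (F.P K) 0) (f : GaugeField (F.P K) 0 (Matrix.specialUnitaryGroup (Fin 2) ℂ) → ℝ) (Λ : ℝ), 0 < Λ →
          Measurable f → GaugeField.GaugeInvariant f →
          (∀ U U' : GaugeField (F.P K) 0 (Matrix.specialUnitaryGroup (Fin 2) ℂ),
            (∀ b : PBond (F.P K) 0, (∀ k, (b.src k - x₀ k).val < n) → (∀ k, (b.tgt k - x₀ k).val < n) → U b = U' b) →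
              f U = f U') →
          (∀ U U' : GaugeField (F.P K) 0 (Matrix.specialUnitaryGroup (Fin 2) ℂ),
            |f U - f U'| ≤ Λ * Real.sqrt (∑ b : PBond (F.P K) 0, GaugeGroup.dist1 (U b * (U' b)⁻¹) ^ 2)) →
          ∀ r : ℝ, 0 ≤ r →
            (gibbsK F ℰp γ K).real {U | r ≤ f U - ∫ V, f V ∂(gibbsK F ℰp γ K)} ≤
              Cc * Real.exp (-(cc * (Real.sqrt ((F.scheme ℰp γ).β K) * r / ((n : ℝ) * Λ)) ^ α)))
    (hF : ∀ (Λ₀ ε₁ : ℝ), 0 < Λ₀ → 0 < ε₁ →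
      ∃ (δ C₀ R₀ : ℝ), 0 < δ ∧ 1 ≤ C₀ ∧ 1 ≤ R₀ ∧
      ∀ (u : Zd 3 → EuclideanSpace ℝ (Fin 4)) (z : Zd 3) (R : ℤ),
      R₀ ≤ R →
      (∀ y, ‖u y‖ = 1) →
      (∀ (z' : Zd 3) (ρ : ℤ), 0 ≤ ρ → box z' (ρ + 1) ⊆ box z R →
      ∀ v : Zd 3 → EuclideanSpace ℝ (Fin 4), (∀ y, y ∉ box z' ρ → v y = u y) → (∀ y ∈ box z' ρ, ‖v y‖ = 1) →
      ∑ y ∈ box z' (ρ + 1), ∑ μ : Fin 3, ‖u (y + unitVec μ) - u y‖ ^ 2 ≤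
      (∑ y ∈ box z' (ρ + 1), ∑ μ : Fin 3, ‖v (y + unitVec μ) - v y‖ ^ 2) + δ * ((ρ : ℝ) + 1)) →
      (∑ y ∈ box z R, ∑ μ : Fin 3, ‖u (y + unitVec μ) - u y‖ ^ 2 ≤ Λ₀ * R) →
      ∃ r : ℤ, 1 ≤ r ∧ (R : ℝ) ≤ C₀ * r ∧ 4 * r ≤ R ∧
      ∑ y ∈ box z (2 * r), ∑ μ : Fin 3, ‖u (y + unitVec μ) - u y‖ ^ 2 ≤ ε₁ * r)
    (hM : Summit.QuantumFields.YangMills.Theses.PoincareLipschitz.MeanDeviationL) :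
    Summit.QuantumFields.YangMills.Theses.UnitScaleTilt.HistoryTailL :=
  historyTailL_of_stretchedConcentration_of_hImprove α hα hC (hImprove_of_core (hImproveCore_of_flat hF)) hM

/-- ★★★ **K2 DISPLAY v4 × K1 SHAPE AXIS (moments)**: `UnitScaleTilt.HistoryTailL ⟸ K1-moments(α) ∧ hImproveCoreFlat ∧ MeanDeviationL` for every
`α > 0` (S4 ∘ K-3 ∘ K-4 ∘ K-5).  Pure composition. [cite: Balaban1985UV3, (7) p.257 and (71) p.273] -/
theorem historyTailL_of_momentGrowth_of_hImproveCoreFlat (α : ℝ) (hα : 0 < α)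
    (hMom : ∀ (L : ℕ), ∃ (CM : ℝ), 0 < CM ∧ ∃ γ₁ : ℝ, 0 < γ₁ ∧ γ₁ ≤ 1 ∧
      ∀ (F : T3Family) (γ : ℝ), F.L = L → 0 < γ → γ ≤ γ₁ → ∀ (K n : ℕ), 1 ≤ n →
        (n : ℝ) ≤ (F.scheme ℰp γ).β K → 2 * n ≤ (F.P K).sitesPerDir 0 →
        ∀ (x₀ : Site (F.P K) 0) (f : GaugeField (F.P K) 0 (Matrix.specialUnitaryGroup (Fin 2) ℂ) → ℝ) (Λ : ℝ), 0 < Λ →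
          Measurable f → GaugeField.GaugeInvariant f →
          (∀ U U' : GaugeField (F.P K) 0 (Matrix.specialUnitaryGroup (Fin 2) ℂ),
            (∀ b : PBond (F.P K) 0, (∀ k, (b.src k - x₀ k).val < n) → (∀ k, (b.tgt k - x₀ k).val < n) → U b = U' b) →
              f U = f U') →
          (∀ U U' : GaugeField (F.P K) 0 (Matrix.specialUnitaryGroup (Fin 2) ℂ),
            |f U - f U'| ≤ Λ * Real.sqrt (∑ b : PBond (F.P K) 0, GaugeGroup.dist1 (U b * (U' b)⁻¹) ^ 2)) →
          ∀ q : ℕ, 1 ≤ q →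
            ∫ U, |f U - ∫ V, f V ∂(gibbsK F ℰp γ K)| ^ q ∂(gibbsK F ℰp γ K) ≤
              (CM * ((n : ℝ) * Λ / Real.sqrt ((F.scheme ℰp γ).β K)) * (q : ℝ) ^ (1 / α)) ^ q)
    (hF : ∀ (Λ₀ ε₁ : ℝ), 0 < Λ₀ → 0 < ε₁ →
      ∃ (δ C₀ R₀ : ℝ), 0 < δ ∧ 1 ≤ C₀ ∧ 1 ≤ R₀ ∧
      ∀ (u : Zd 3 → EuclideanSpace ℝ (Fin 4)) (z : Zd 3) (R : ℤ),
      R₀ ≤ R →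
      (∀ y, ‖u y‖ = 1) →
      (∀ (z' : Zd 3) (ρ : ℤ), 0 ≤ ρ → box z' (ρ + 1) ⊆ box z R →
      ∀ v : Zd 3 → EuclideanSpace ℝ (Fin 4), (∀ y, y ∉ box z' ρ → v y = u y) → (∀ y ∈ box z' ρ, ‖v y‖ = 1) →
      ∑ y ∈ box z' (ρ + 1), ∑ μ : Fin 3, ‖u (y + unitVec μ) - u y‖ ^ 2 ≤
      (∑ y ∈ box z' (ρ + 1), ∑ μ : Fin 3, ‖v (y + unitVec μ) - v y‖ ^ 2) + δ * ((ρ : ℝ) + 1)) →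
      (∑ y ∈ box z R, ∑ μ : Fin 3, ‖u (y + unitVec μ) - u y‖ ^ 2 ≤ Λ₀ * R) →
      ∃ r : ℤ, 1 ≤ r ∧ (R : ℝ) ≤ C₀ * r ∧ 4 * r ≤ R ∧
      ∑ y ∈ box z (2 * r), ∑ μ : Fin 3, ‖u (y + unitVec μ) - u y‖ ^ 2 ≤ ε₁ * r)
    (hM : Summit.QuantumFields.YangMills.Theses.PoincareLipschitz.MeanDeviationL) :
    Summit.QuantumFields.YangMills.Theses.UnitScaleTilt.HistoryTailL :=
  historyTailL_of_momentGrowth_of_hImprove α hα hMom (hImprove_of_core (hImproveCore_of_flat hF)) hM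

end Summit.QuantumFields.YangMills.Theorems.PoincareLipschitzStretched

end
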